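import Summits.ResolutionOfSingularities.ResolutionOfSingularities.Theorems.WeightedInvariantHypersurfaceLocalGameEFT4SDimLETwoOpenClosedPoint
import Summits.ResolutionOfSingularities.ResolutionOfSingularities.Theorems.WeightedInvariantHypersurfaceLocalGameEFT4SDimLETwoOpenMonomial
import Summits.ResolutionOfSingularities.ResolutionOfSingularities.Theorems.WeightedInvariantContactCentreFiltration
import Literature.RingTheory.RegularLocalRing.QuotientDVR
import HarnessLib

/-!
# (open″)↾≤2 for `(iotaOrd, jContact)` — the ASSEMBLY of ORDER (o24-O) modulo the two `jContact` presentation facts of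
# (o24-D)/(o24-G) (door `HypersurfaceCentreConstruction`, stmt-ResolutionOfSingularities-19897 · rung P2; lead res-type-005,
# second hand res-type-025; res-L1-w43-plan-1 ASSIGNMENT 2026-08-27T08:16:45Z)

Topic: `Summits/ResolutionOfSingularities/ResolutionOfSingularities/Theorems`. Helper for the door item
`HypersurfaceCentreConstruction` (stmt-ResolutionOfSingularities-19897, route `WeightedInvariant`). The conjunct
`JOpenPresentationForallSingLE2 p iotaOrd jContact` of the P2 rung (`…EFT4SDimLETwo`, p512950) BY CASES on the position
`(A, 𝔪, F)`: MONOMIAL TYPE (`F/1 = v·γ^ν`, `γ` a regular parameter; every position of Krull dimension `1`) = res-type-025's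
`LocalGameEFTOpenMonomial.jOpenPresentationForallSing_body_of_monomialType` (p515455); NOT monomial type ⇒ Krull dimension
exactly `2` (dimension `0`: `F/1 = 0`; dimension `1`: a DVR, every non-zero non-unit is of monomial type) ⇒ the case-(iii) engine
`GenericEquimultiplicity.jOpenPresentationForallSingLE2_body_of_strat_maximalIdeal` (p516179) fed by res-type-073's (strat) with
centre the maximal ideal (`IotaOrderStrat.strat_maximalIdeal_of_forall_ne`, p509553). The two inputs about the centre filtration
`jContact` (res-type-092's (o24-D), res-type-098's (o24-G) case B) are taken here as EXPLICIT HYPOTHESES in their producers'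
shapes — `hJmono` (= res-type-025's `hJ`: `jContact R (v·g^ν) = (g)ᵐ` at monomial type, 092's `jContact_of_eq_unit_mul_pow`)
and `hcaseB` (at a non-monomial position of dimension `2`: a presentation of `jContact S f` by a positively weighted system with
independent cotangent images spanning `𝔪_S` — 098's terminal certificate `(x, y_T; 1, b_T)` through 092's
`weightedMonomialIdeal_eq_jContact`) — so that the conjunct closes by `exact` the moment those two land. [OURS · L1 W4.3]
Replaces the role of NO printed item; NOT a statement of the manuscript [claim: Hironaka2017, status: under-review]. AI work,
weaker than expert review.

## References

* V. Cossart, O. Piltant, J. Algebra 320 (2008), proof of Prop. 4.2. [cite: CossartPiltant2008, Prop. 4.2 (proof)]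
* V. Cossart, U. Jannsen, S. Saito, LNM 2270 (2020), Ch. 8 (maximal contact in dimension two). [CossartJannsenSaito2020]
-/

noncomputable section

open IsLocalRing Literature.AlgebraicGeometry.Resolution
open Summit.ResolutionOfSingularities.ResolutionOfSingularities.Cruxes.HypersurfaceCentreConstruction.LocalEngine

set_option linter.dupNamespace false -- mandated namespace of this single-conjunct summit

namespace Summit.ResolutionOfSingularities.ResolutionOfSingularities.Theorems

namespace GenericEquimultiplicity

/-- **In a regular local ring of Krull dimension ≤ 1, every non-zero element of `𝔪²` is of monomial type** (dimension `0` is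
excluded by `0 ≠ f ∈ 𝔪² = 0`; in dimension `1` the ring is a DVR and `f = υ ϖⁿ`). [cite: Matsumura1987, Thm. 11.2] -/
theorem isMonomialType_of_ringKrullDim_le_one {S : Type} [CommRing S] [IsRegularLocalRing S]
    (hdim : ringKrullDim S ≤ 1) {f : S} (hf0 : f ≠ 0) (hf2 : f ∈ maximalIdeal S ^ 2) : IsMonomialType f := by
  classical
  haveI := isDomain_of_isRegularLocalRing S
  -- the dimension is `0` or `1`
  have hsf := IsRegularLocalRing.spanFinrank_maximalIdeal (R := S)
  set d := (maximalIdeal S).spanFinrank with hd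
  have hd1 : d ≤ 1 := by
    have : (d : WithBot ℕ∞) ≤ 1 := by rw [hsf]; exact hdim
    exact_mod_cast this
  rcases Nat.le_one_iff_eq_zero_or_eq_one.mp hd1 with h0 | h1
  · -- dimension `0`: `𝔪 = ⊥`, so `f = 0`
    exfalso
    have hbot : maximalIdeal S = ⊥ :=
      (Submodule.spanFinrank_eq_zero_iff_eq_bot (IsNoetherian.noetherian _)).mp h0
    have hf : f ∈ maximalIdeal S := Ideal.pow_le_self two_ne_zero hf2
    rw [hbot] at hf
    exact hf0 ((Submodule.mem_bot _).mp hf)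
  · -- dimension `1`: a DVR
    have hdim1 : ringKrullDim S = 1 := by rw [← hsf, h1]; rfl
    haveI : IsDiscreteValuationRing S :=
      Literature.RingTheory.RegularLocalRing.isDiscreteValuationRing_of_ringKrullDim_eq_one hdim1
    obtain ⟨ϖ, hirr⟩ := IsDiscreteValuationRing.exists_irreducible S
    have h𝔪 : maximalIdeal S = Ideal.span {ϖ} := (IsDiscreteValuationRing.irreducible_iff_uniformizer ϖ).mp hirr
    obtain ⟨n, υ, hfυ⟩ := IsDiscreteValuationRing.eq_unit_mul_pow_irreducible hf0 hirr
    refine ⟨υ, ϖ, n, υ.isUnit, ?_, ?_, hfυ⟩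
    · rw [h𝔪]; exact Ideal.mem_span_singleton_self ϖ
    · rw [h𝔪, Ideal.span_singleton_pow, Ideal.mem_span_singleton]
      rintro ⟨c, hc⟩
      apply hirr.not_isUnit
      refine isUnit_iff_exists_inv.mpr ⟨c, mul_left_cancel₀ hirr.ne_zero ?_⟩
      rw [mul_one, ← mul_assoc, ← pow_two]
      exact hc.symm

/-- **(open″)↾≤2 for `(iotaOrd, jContact)`, modulo the two `jContact` presentation facts** (res-type-092's
`jContact_of_eq_unit_mul_pow` = `hJmono`; res-type-098's case-B terminal certificate through 092's `weightedMonomialIdeal_eq_jContact`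
= `hcaseB`): the conjunct `JOpenPresentationForallSingLE2 p iotaOrd jContact` of the P2 rung. Case split on the monomial type of
`F/1`: monomial ⇒ res-type-025's theorem (p515455); otherwise the position has Krull dimension exactly `2`
(`isMonomialType_of_ringKrullDim_le_one`) and the case-(iii) engine (p516179) applies with res-type-073's (strat) at the maximal
ideal. [OURS · L1 W4.3 · (o24-O) assembly] [cite: CossartPiltant2008, Prop. 4.2 (proof)] -/
theorem jOpenPresentationForallSingLE2_iotaOrd_jContact_of
    (hJmono : ∀ (R : Type) [CommRing R] [IsRegularLocalRing R] (v g : R) (ν : ℕ), IsUnit v → g ∈ maximalIdeal R →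
      g ∉ maximalIdeal R ^ 2 → 1 ≤ ν → ∀ m : ℕ, jContact R (v * g ^ ν) m = Ideal.span {g} ^ m)
    (hcaseB : ∀ (k₀ : Type) [Field k₀] [PerfectField k₀] (S : Type) [CommRing S] [IsRegularLocalRing S] [Algebra k₀ S]
      [Algebra.EssFiniteType k₀ S], ringKrullDim S = (2 : ℕ) → ∀ f : S, f ≠ 0 → f ∈ maximalIdeal S ^ 2 →
      ¬ IsMonomialType f →
      ∃ (N : ℕ) (xy : Fin N → S) (W : Fin N → ℕ) (hxy : ∀ i, xy i ∈ maximalIdeal S), (∀ i, 0 < W i) ∧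
        Ideal.span (Set.range xy) = maximalIdeal S ∧
        LinearIndependent (ResidueField S) (fun i => ((maximalIdeal S).toCotangent ⟨xy i, hxy i⟩ : CotangentSpace S)) ∧
        ∀ m : ℕ, jContact S f m = weightedMonomialIdeal xy W m)
    (p : ℕ) : JOpenPresentationForallSingLE2 p iotaOrd jContact := by
  intro k₀ _ _ _ A _ _ _ 𝔪 _ F hreg hdim hF0 hF2
  haveI := hreg
  by_cases hmono : IsMonomialType (algebraMap A (Localization.AtPrime 𝔪) F)
  · obtain ⟨v, γ, ν, hv, hγ, hγ2, hF⟩ := hmono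
    exact LocalGameEFTOpenMonomial.jOpenPresentationForallSing_body_of_monomialType jContact hJmono k₀ A 𝔪 F hreg hF2
      ⟨v, γ, ν, hv, hγ, hγ2, hF⟩
  · -- not of monomial type: the position has Krull dimension exactly `2`
    have hsf := IsRegularLocalRing.spanFinrank_maximalIdeal (R := Localization.AtPrime 𝔪)
    have hd2 : ringKrullDim (Localization.AtPrime 𝔪) = (2 : ℕ) := by
      rw [← hsf] at hdim ⊢
      have hdle : (maximalIdeal (Localization.AtPrime 𝔪)).spanFinrank ≤ 2 := by exact_mod_cast hdim
      rcases Nat.lt_or_ge (maximalIdeal (Localization.AtPrime 𝔪)).spanFinrank 2 with hlt | hge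
      · exfalso
        refine hmono (isMonomialType_of_ringKrullDim_le_one ?_ hF0 hF2)
        rw [← hsf]
        exact_mod_cast Nat.lt_succ_iff.mp hlt
      · exact_mod_cast le_antisymm hdle hge
    haveI : Algebra.EssFiniteType k₀ (Localization.AtPrime 𝔪) :=
      Algebra.EssFiniteType.comp k₀ A (Localization.AtPrime 𝔪)
    obtain ⟨N, xy, W, hxy, hW, hspan, hli, hJ⟩ :=
      hcaseB k₀ (Localization.AtPrime 𝔪) hd2 _ hF0 hF2 hmono
    obtain ⟨-, -, -, hstrat⟩ := IotaOrderStrat.strat_maximalIdeal_of_forall_ne (S := Localization.AtPrime 𝔪) hdim hF0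
      (Ideal.pow_le_self two_ne_zero hF2) (fun v g n hv hg hg2 hfe => hmono ⟨v, g, n, hv, hg, hg2, hfe⟩)
    exact jOpenPresentationForallSingLE2_body_of_strat_maximalIdeal p jContact k₀ A 𝔪 F hreg hd2 hF0 hF2
      (fun 𝔭 _ hF𝔭 => hstrat 𝔭 hF𝔭) xy W hW hxy hspan hli hJ

end GenericEquimultiplicity

end Summit.ResolutionOfSingularities.ResolutionOfSingularities.Theorems

end
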